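import Literature.NumberTheory.LFunctions.TaoLogElliottUnimodular
import Literature.NumberTheory.LFunctions.HallTenenbaumTheorem01
import Literature.NumberTheory.LFunctions.MertensElementary
import HarnessLib

/-!
# Tao's log-averaged Elliott theorem: Proposition 2.1 and the §2 reduction, discharged

Sixth layer of the proof DAG below the named fact `Literature.NumberTheory.LFunctions.tao_log_averaged_elliott_two`
(Tao, Forum Math. Pi 4 (2016) e8, Theorem 1.3).  `TaoLogElliottUnimodular.lean` proves
Proposition 2.1 from the mean value bound `Literature.Tao2016.AbsMeanValueBound C` for moduli of
multiplicative functions (there derived from the named fact recording Halász's inequality).  Here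
that bound is PROVED unconditionally from the elementary Hall–Tenenbaum (Halberstam–Richert)
upper bound `HallTenenbaumTheorem01.lean` and Mertens' bound `∑_{p ≤ N} 1/p ≤ log log N + 4`
(`MertensElementary.lean`):

* `Literature.Tao2016.absMeanValueBound_holds : ∃ C > 0, AbsMeanValueBound C` — for `1`-bounded
  multiplicative `g`, `y ≥ 3` and `0 ≤ D ≤ ∑_{p ≤ y} (1 - |g(p)|)/p`:
  `∑_{n ≤ y} |g(n)| ≤ C y e^{-D}` with `C = (log 4 + B₁ + 1) e^5` (Theorem 01 with `A = log 4`,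
  `B = B₁`, then (0.4): `∑_{n ≤ y} |g(n)|/n ≤ exp(1 + ∑_{p ≤ y} |g(p)|/p) = exp(1 + ∑_{p ≤ y} 1/p - D(g; y))
  ≤ e^5 (log y) e^{-D}`);
* `Literature.Tao2016_prop21_holds : Tao2016_prop21` — **Proposition 2.1 discharged**;
* `Literature.Tao2016_section2_reduction_holds : Tao2016_section2_reduction` — **the whole §2 reduction
  discharged**: Theorem 2.3 (`Literature.NumberTheory.LFunctions.Tao2016_theorem23`) implies Theorem 1.3
  (`Literature.NumberTheory.LFunctions.tao_log_averaged_elliott_two`); `Literature.NumberTheory.LFunctions.tao_log_averaged_elliott_two_of_theorem23'`.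

Remaining DAG for `tao_log_averaged_elliott_two`: `Tao2016_theorem23` only (§§3–4 of the paper:
Matomäki–Radziwiłł–Tao, entropy decrement, Hoeffding, circle method, Green–Tao restriction
estimate).

## References
* T. Tao, *The logarithmically averaged Chowla and Elliott conjectures for two-point
  correlations*, Forum Math. Pi 4 (2016), e8; arXiv:1509.05422, §2, Proposition 2.1 (whose proof
  invokes "the Halasz inequality" for the nonnegative function `g'₁ = |g₁|`; for such functions the
  Hall–Tenenbaum bound gives the same conclusion) and the paragraph before Theorem 2.3.
* R. R. Hall, G. Tenenbaum, *Divisors*, CUP 1988, Theorem 01 and (0.4).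
-/

namespace Literature.NumberTheory.LFunctions

open Finset Tao2016

/-- **The mean value bound for `|g|`, unconditionally** (from Hall–Tenenbaum's Theorem 01 with
`A = log 4`, `B = B₁`, inequality (0.4), and Mertens' bound `∑_{p ≤ N} 1/p ≤ log log N + 4`):
`∑_{n ≤ y} |g(n)| ≤ C y e^{-D}` for `0 ≤ D ≤ ∑_{p ≤ y} (1 - |g(p)|)/p`, with
`C = (log 4 + B₁ + 1) e^5`; in particular `AbsMeanValueBound C`. [folklore] -/
theorem Tao2016.absMeanValueBound_holds : ∃ C : ℝ, 0 < C ∧ AbsMeanValueBound C := by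
  have hB := HallTenenbaum.B₁_nonneg
  have hlog4 : 0 ≤ Real.log 4 := Real.log_nonneg (by norm_num)
  refine ⟨(Real.log 4 + HallTenenbaum.B₁ + 1) * Real.exp 5, by positivity, ?_⟩
  intro g hg hb y D hy hD hDM
  set f : ℕ → ℝ := fun n => ‖g n‖ with hf
  have hf1 : f 1 = 1 := by simp [hf, hg.map_one]
  have hmul : ∀ m n : ℕ, Nat.Coprime m n → f (m * n) = f m * f n := fun m n h => by
    simp [hf, hg.map_mul_of_coprime h]
  have hf0 : ∀ n, 0 ≤ f n := fun n => norm_nonneg _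
  have hf1' : ∀ n, f n ≤ 1 := hb
  have hy1 : 1 < y := by linarith
  have hypos : 0 < y := by linarith
  have hlogy : 0 < Real.log y := Real.log_pos hy1
  set N := ⌊y⌋₊ with hN
  have hN3 : 3 ≤ N := Nat.le_floor (by exact_mod_cast hy)
  have hN2 : 2 ≤ N := by omega
  have hNy : (N : ℝ) ≤ y := Nat.floor_le hypos.le
  have hN0 : (3 : ℝ) ≤ N := by exact_mod_cast hN3
  have hlogN : 0 < Real.log N := Real.log_pos (by linarith)
  have h1 := HallTenenbaum.sum_le_of_le_one hf1 hmul hf0 hf1' hy1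
  -- `∑_{p ≤ y} |g(p)|/p = ∑_{p ≤ y} 1/p - D(g; y) ≤ log log N + 4 - D`
  have h2 : ∑ p ∈ Nat.primesLE N, f p / p
      = ∑ p ∈ Nat.primesLE N, (1 : ℝ) / p - modulusDist g y := by
    rw [modulusDist_eq_sum, ← hN, ← Finset.sum_sub_distrib]
    refine Finset.sum_congr rfl fun p _ => ?_
    simp only [hf]
    ring
  have h3 := MertensBound.sum_inv_prime_le N hN2
  have h4 : Real.log (Real.log N) ≤ Real.log (Real.log y) :=
    Real.log_le_log hlogN (Real.log_le_log (by linarith) hNy)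
  have hE : 1 + ∑ p ∈ Nat.primesLE N, f p / p ≤ 5 + Real.log (Real.log y) - D := by
    rw [h2]; linarith
  have h5 : Real.exp (1 + ∑ p ∈ Nat.primesLE N, f p / p)
      ≤ Real.exp 5 * Real.log y * Real.exp (-D) := by
    calc _ ≤ Real.exp (5 + Real.log (Real.log y) - D) := Real.exp_le_exp.mpr hE
      _ = Real.exp 5 * Real.log y * Real.exp (-D) := by
          rw [sub_eq_add_neg, Real.exp_add, Real.exp_add, Real.exp_log hlogy]
  have hK : 0 ≤ (Real.log 4 + HallTenenbaum.B₁ + 1) * (y / Real.log y) := by positivity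
  calc ∑ n ∈ Icc 1 N, ‖g n‖ = ∑ n ∈ Icc 1 N, f n := rfl
    _ ≤ (Real.log 4 + HallTenenbaum.B₁ + 1) * (y / Real.log y)
          * Real.exp (1 + ∑ p ∈ Nat.primesLE N, f p / p) := h1
    _ ≤ (Real.log 4 + HallTenenbaum.B₁ + 1) * (y / Real.log y)
          * (Real.exp 5 * Real.log y * Real.exp (-D)) := mul_le_mul_of_nonneg_left h5 hK
    _ = (Real.log 4 + HallTenenbaum.B₁ + 1) * Real.exp 5 * y * Real.exp (-D) := by
          field_simp
    _ ≤ (Real.log 4 + HallTenenbaum.B₁ + 1) * Real.exp 5 * y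
          * ((2 + D) * Real.exp (-D) + 1 / Real.log y) := by
          refine mul_le_mul_of_nonneg_left ?_ (by positivity)
          have h6 : 0 ≤ 1 / Real.log y := by positivity
          have h7 : 0 ≤ (1 + D) * Real.exp (-D) := by positivity
          nlinarith

/-- **Tao 2016, Proposition 2.1, PROVED** (`Literature.NumberTheory.LFunctions.Tao2016_prop21`): Theorem 1.3 for `S¹`-valued
`g₁` implies Theorem 1.3.  The paper's appeal to Halász's inequality (for the nonnegative function
`|g₁|`) is served by the elementary Hall–Tenenbaum bound (`absMeanValueBound_holds`).
[cite: TaoFMP2016, Proposition 2.1] -/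
theorem Tao2016_prop21_holds : Tao2016_prop21 := by
  obtain ⟨C, hC, hMV⟩ := Tao2016.absMeanValueBound_holds
  exact Tao2016_prop21_of_mv hC hMV

/-- **Tao 2016, §2: Theorem 2.3 implies Theorem 1.3, PROVED** (`Literature.NumberTheory.LFunctions.Tao2016_section2_reduction`):
all four printed reduction steps (Prop. 2.1, its `g₂`-analogue, Prop. 2.2, its `g₂`-analogue) and
the rescaling / `ω ≤ x/log x` step are now theorems.
[cite: TaoFMP2016, §2 (paragraph before Theorem 2.3)] -/
theorem Tao2016_section2_reduction_holds : Tao2016_section2_reduction := by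
  obtain ⟨C, hC, hMV⟩ := Tao2016.absMeanValueBound_holds
  exact Tao2016_section2_reduction_of_mv hC hMV

/-- **Theorem 1.3 from Theorem 2.3** (`Literature.NumberTheory.LFunctions.tao_log_averaged_elliott_two` from
`Literature.NumberTheory.LFunctions.Tao2016_theorem23` alone). [cite: TaoFMP2016, §2] -/
theorem tao_log_averaged_elliott_two_of_theorem23' (h23 : Tao2016_theorem23) :
    tao_log_averaged_elliott_two :=
  Tao2016_section2_reduction_holds h23

end Literature.NumberTheory.LFunctions
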